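import Summits.SmoothPoincare4.SmoothPoincare4.Theorems.DottedCircleRasmussenDcrGapStubFriendsH2Aux3
import Summits.SmoothPoincare4.SmoothPoincare4.Theorems.DottedCircleRasmussenDcrGapHelperFriendsPi1G3Aux2
import Summits.SmoothPoincare4.SmoothPoincare4.Theorems.DottedCircleRasmussenDcrGapHelperFriendsPi1G3Aux3
import Summits.SmoothPoincare4.SmoothPoincare4.Theses.DottedCircleRasmussen

/-!
# Helper `helper_friendsPi1_G3`: loops based off the core are homotopic to loops off the core
(sub-goal G3 of stub `stub_friendsPi1`, line `mk_friends`, skeleton v3, crux `DcrGap`;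
item stmt-SmoothPoincare4-16128, route route-SmoothPoincare4-DottedCircleRasmussen)

Line `mk_friends` glues a closed smooth `4`-manifold `X ⊃ C = i(D_k) ∪ f₀(𝔻²)`: `i` is a germ chart
(smooth, injective, immersive on an open `U ⊇ D_k`) of the model dotted handlebody
`D_k = MMSW.modelHandlebody k`, and `f₀` is the core disc of the `2`-handle.  Stub B (`stub_friendsPi1`,
`π₁(X) = 1`) needs `π₁(X ∖ C) → π₁(X)` onto; this file proves exactly that, as the registered helper
`helper_friendsPi1_G3`: **every loop of `X` based at a point off `C` is homotopic rel base point to a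
loop off `C`.**

**Proof.**  Twice the path-cover lemma (aux file 1, `helper_friendsPi1_G3_cover`, the decomposition
of Hatcher's proof of van Kampen's theorem, Lemma 1.15):

1. *Off `i(D_k)`.*  Cover `X` by `X ∖ i(D_k)` (open: `i(D_k)` is compact) and `i(U₁)` (open: `i|_U`
   is an open embedding, `FriendsH2.isOpenEmbedding_restrict_of_germChart`), where `U₁ ⊇ D_k` is the
   thickening of aux file 3 (`helper_friendsPi1_G3_push`): points of `D_k` exit `D_k` inside `U₁`,
   and a path in `i(U₁)` with end points off `i(D_k)` lifts through the embedding to a path in `U₁`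
   with end points off `D_k`, which is homotopic within `U₁` to a path off `D_k` (general position
   with respect to the planar cores, then the radial push in `w`); `i` carries the homotopy back.
2. *Off `f₀(𝔻²)`, staying off `i(D_k)`.*  Cover the new loop by `X ∖ C` and by the good chart balls
   `N ⊆ X ∖ i(D_k)` of aux file 2 (`helper_friendsPi1_G3_genpos`: `f₀(𝔻²)` has codimension `2`, so
   inside `N` points are joined to points off it and paths with end points off it are moved off it,
   Hurewicz–Wallman (1941) Thm. IV 4).

Only the germ-chart clause and the smoothness of `f₀` are used; the remaining disc data of the
signature (injectivity and immersivity of `f₀`, the collar `g₀`, the knot `K₀`) are not needed here.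
Everything is proved; no definitions, no named facts, no `sorry`.

## References

* A. Hatcher, *Algebraic Topology*, CUP (2002), §1.2, proof of Lemma 1.15. [HatcherAT2002]
* W. Hurewicz, H. Wallman, *Dimension Theory*, Princeton (1941), Ch. IV §5, Thm. IV 4. [HurewiczWallman1941]
-/

-- the prescribed namespace `Summit.<P>.<Sub>.…` duplicates `SmoothPoincare4` (P = Sub)
set_option linter.dupNamespace false
set_option linter.style.longLine false

noncomputable section

open scoped Manifold ContDiff Topology unitInterval
open Function Set Metric
open Literature.Topology.FourManifolds Literature.Topology.FourManifolds.MMSW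
open Literature.AlgebraicTopology.FundamentalGroup.VanKampen (HomotopicWithin)

namespace Summit.SmoothPoincare4.SmoothPoincare4.Theorems.DcrGap.MkFriends

namespace FriendsPi1

variable {X : Type} [TopologicalSpace X]

/-! ## Step 1: off the handlebody `i(D_k)` -/

/-- **Loops off `i(D_k)`.**  For a map `i : ℝ⁴ → X` which is continuous and injective on an open
`U ⊇ D_k` with `i|_U` an open embedding, every path of `X` with end points off `i(D_k)` is homotopic
rel end points to a path off `i(D_k)` (path-cover lemma with the cover `{X ∖ i(D_k), i(U₁)}`, `U₁` the
thickening of `helper_friendsPi1_G3_push`; paths in `i(U₁)` are lifted through the embedding, pushed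
off `D_k` inside `U₁`, and mapped back). [cite: HatcherAT2002, Lemma 1.15] -/
theorem exists_path_notMem_image_modelHandlebody [T2Space X] {k : ℕ} {U : Set (EuclideanSpace ℝ (Fin 4))}
    {i : EuclideanSpace ℝ (Fin 4) → X} (hUo : IsOpen U) (hDU : modelHandlebody k ⊆ U)
    (hic : ContinuousOn i U) (hinj : InjOn i U) (hemb : Topology.IsOpenEmbedding (U.restrict i))
    {x y : X} (γ : Path x y) (hx : x ∉ i '' modelHandlebody k) (hy : y ∉ i '' modelHandlebody k) :
    ∃ γ' : Path x y, (∀ s, γ' s ∉ i '' modelHandlebody k) ∧ γ.Homotopic γ' := by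
  set A : Set X := i '' modelHandlebody k with hA
  have hAcl : IsClosed A := ((isCompact_modelHandlebody k).image_of_continuousOn (hic.mono hDU)).isClosed
  obtain ⟨U₁, hU₁o, hDU₁, hU₁U, hexit, hpush⟩ := helper_friendsPi1_G3_push k U hUo hDU
  have hic₁ : ContinuousOn i U₁ := hic.mono hU₁U
  -- `i(U₁)` is open
  have hiU₁o : IsOpen (i '' U₁) := by
    have e : i '' U₁ = (U.restrict i) '' (Subtype.val ⁻¹' U₁) := by
      ext p
      constructor
      · rintro ⟨z, hz, rfl⟩; exact ⟨⟨z, hU₁U hz⟩, hz, rfl⟩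
      · rintro ⟨⟨z, hzU⟩, hz, rfl⟩; exact ⟨z, hz, rfl⟩
    rw [e]; exact hemb.isOpenMap _ (hU₁o.preimage continuous_subtype_val)
  -- points of `i(U₁)` off `A` come from points off `D_k`
  have hnotA : ∀ z ∈ U₁, z ∉ modelHandlebody k → i z ∉ A := fun z hz hzD ⟨d, hd, hdz⟩ =>
    hzD (hinj (hU₁U hz) (hDU hd) hdz.symm ▸ hd)
  have hofA : ∀ z ∈ U₁, i z ∉ A → z ∉ modelHandlebody k := fun z _ hz hzD => hz ⟨z, hzD, rfl⟩
  -- lifting paths of `i(U₁)` through the embedding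
  have hlift : ∀ {p q : X} (β : Path p q), (∀ s, β s ∈ i '' U₁) →
      ∃ (a b : EuclideanSpace ℝ (Fin 4)) (β₁ : Path a b), (∀ s, β₁ s ∈ U₁) ∧ ∀ s, β s = i (β₁ s) := by
    intro p q β hβ
    choose ℓ hℓU₁ hℓi using hβ
    have hcont : Continuous ℓ := by
      have h1 : Continuous fun s => (⟨ℓ s, hU₁U (hℓU₁ s)⟩ : U) := by
        rw [hemb.isInducing.continuous_iff]
        have e : (U.restrict i) ∘ (fun s => (⟨ℓ s, hU₁U (hℓU₁ s)⟩ : U)) = β := funext fun s => hℓi s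
        rw [e]; exact β.continuous
      exact continuous_subtype_val.comp h1
    exact ⟨ℓ 0, ℓ 1, ⟨⟨ℓ, hcont⟩, rfl, rfl⟩, hℓU₁, fun s => (hℓi s).symm⟩
  -- the cover `{X ∖ A, i(U₁)}`
  set V : Bool → Set X := fun b => cond b Aᶜ (i '' U₁) with hV
  have hVo : ∀ b, IsOpen (V b) := by
    rintro (_ | _)
    · exact hiU₁o
    · exact hAcl.isOpen_compl
  have h1 : ∀ b b' (p : X), p ∈ A → p ∈ V b → p ∈ V b' →
      ∃ q : X, q ∉ A ∧ ∃ δ : Path p q, ∀ s, δ s ∈ V b ∧ δ s ∈ V b' := by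
    rintro (_ | _) (_ | _) p hpA hp hp'
    · obtain ⟨d, hd, rfl⟩ := hpA
      obtain ⟨d', hd'U₁, hd'D, hj⟩ := hexit d hd
      have hδm : ∀ s, hj.somePath s ∈ U₁ := hj.somePath_mem
      refine ⟨i d', hnotA d' hd'U₁ hd'D, hj.somePath.map' (hic₁.mono (range_subset_iff.2 hδm)),
        fun s => ⟨⟨_, hδm s, rfl⟩, ⟨_, hδm s, rfl⟩⟩⟩
    · exact absurd hpA hp'
    · exact absurd hpA hp
    · exact absurd hpA hp
  have h2 : ∀ b (p q : X) (β : Path p q), (∀ s, β s ∈ V b) → p ∉ A → q ∉ A →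
      ∃ β' : Path p q, (∀ s, β' s ∉ A) ∧ β.Homotopic β' := by
    rintro (_ | _) p q β hβ hp hq
    · obtain ⟨a, b, β₁, hβ₁, hβi⟩ := hlift β hβ
      have ha : a ∉ modelHandlebody k := hofA a (by simpa using hβ₁ 0) (by
        rw [← β₁.source, ← hβi, β.source]; exact hp)
      have hb : b ∉ modelHandlebody k := hofA b (by simpa using hβ₁ 1) (by
        rw [← β₁.target, ← hβi, β.target]; exact hq)
      obtain ⟨β₁', hβ₁', hhom⟩ := hpush a b β₁ hβ₁ ha hb
      obtain ⟨β', hβ', hββ'⟩ := exists_path_of_homotopicWithin hic₁ hhom β hβi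
      exact ⟨β', fun s => by rw [hβ' s]; exact hnotA _ (hβ₁' s).1 (hβ₁' s).2, hββ'⟩
    · exact ⟨β, hβ, Path.Homotopic.refl β⟩
  have hcov : ∀ t, ∃ b, γ t ∈ V b := fun t => by
    by_cases h : γ t ∈ A
    · exact ⟨false, image_mono hDU₁ h⟩
    · exact ⟨true, h⟩
  exact helper_friendsPi1_G3_cover X Bool A V hVo h1 h2 x y γ hcov hx hy

/-! ## Step 2: off the core disc, staying off the handlebody -/

/-- **Loops off `A ∪ S` from loops off `A`.**  If `A` is closed and `S ⊆ f(ℝ²)` for a smooth map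
`f : ℝ² → X` into the smooth `4`-manifold `X`, every path off `A` with end points off `A ∪ S` is
homotopic rel end points to a path off `A ∪ S` (path-cover lemma with the cover by `X ∖ (A ∪ S)` and
the good chart balls of `helper_friendsPi1_G3_genpos` inside `X ∖ A`; Hurewicz–Wallman (1941),
Thm. IV 4). [cite: HurewiczWallman1941, Ch. IV §5, Thm. IV 4 and Cor. 1] -/
theorem exists_path_notMem_union [ChartedSpace (EuclideanSpace ℝ (Fin 4)) X] [IsManifold (𝓡 4) ∞ X]
    {f : EuclideanSpace ℝ (Fin 2) → X} (hf : ContMDiff (𝓡 2) (𝓡 4) ∞ f) {A S : Set X}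
    (hA : IsClosed A) (hAS : IsClosed (A ∪ S)) (hS : S ⊆ range f) {x y : X} (γ : Path x y)
    (hγ : ∀ s, γ s ∉ A) (hx : x ∉ A ∪ S) (hy : y ∉ A ∪ S) :
    ∃ γ' : Path x y, (∀ s, γ' s ∉ A ∪ S) ∧ γ.Homotopic γ' := by
  have hgen := helper_friendsPi1_G3_genpos X f S hf hS
  -- the cover: `X ∖ (A ∪ S)` and the good chart balls inside `X ∖ A`
  let κ := {N : Set X // IsOpen N ∧ N ⊆ Aᶜ ∧ ∀ (p q : X) (β : Path p q), (∀ s, β s ∈ N) → p ∉ S →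
    q ∉ S → ∃ β' : Path p q, (∀ s, β' s ∈ N ∧ β' s ∉ S) ∧ β.Homotopic β'}
  set V : Option κ → Set X := fun o => Option.elim o (A ∪ S)ᶜ fun N => N.1 with hV
  have hVo : ∀ o, IsOpen (V o) := by
    rintro (_ | N)
    · exact hAS.isOpen_compl
    · exact N.2.1
  have h1 : ∀ o o' (p : X), p ∈ A ∪ S → p ∈ V o → p ∈ V o' →
      ∃ q : X, q ∉ A ∪ S ∧ ∃ δ : Path p q, ∀ s, δ s ∈ V o ∧ δ s ∈ V o' := by
    rintro (_ | N) (_ | N') p hpC hp hp'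
    · exact absurd hpC hp
    · exact absurd hpC hp
    · exact absurd hpC hp'
    · obtain ⟨N₀, -, hpN₀, hN₀, ha, -⟩ := hgen p (N.1 ∩ N'.1) ((N.2.1.inter N'.2.1).mem_nhds ⟨hp, hp'⟩)
      obtain ⟨q, hq, hqS, δ, hδ⟩ := ha p hpN₀
      refine ⟨q, ?_, δ, fun s => hN₀ (hδ s)⟩
      rintro (hqA | hqS')
      · exact N.2.2.1 (hN₀ hq).1 hqA
      · exact hqS hqS'
  have h2 : ∀ o (p q : X) (β : Path p q), (∀ s, β s ∈ V o) → p ∉ A ∪ S → q ∉ A ∪ S →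
      ∃ β' : Path p q, (∀ s, β' s ∉ A ∪ S) ∧ β.Homotopic β' := by
    rintro (_ | N) p q β hβ hp hq
    · exact ⟨β, hβ, Path.Homotopic.refl β⟩
    · obtain ⟨β', hβ', hββ'⟩ := N.2.2.2 p q β hβ (fun h => hp (Or.inr h)) (fun h => hq (Or.inr h))
      refine ⟨β', fun s => ?_, hββ'⟩
      rintro (h | h)
      · exact N.2.2.1 (hβ' s).1 h
      · exact (hβ' s).2 h
  have hcov : ∀ t, ∃ o, γ t ∈ V o := fun t => by
    by_cases h : γ t ∈ A ∪ S
    · obtain ⟨N, hNo, htN, hNA, -, hb⟩ := hgen (γ t) Aᶜ (hA.isOpen_compl.mem_nhds (hγ t))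
      exact ⟨some ⟨N, hNo, hNA, hb⟩, htN⟩
    · exact ⟨none, h⟩
  exact helper_friendsPi1_G3_cover X (Option κ) (A ∪ S) V hVo h1 h2 x y γ hcov hx hy

end FriendsPi1

/-- **Helper `helper_friendsPi1_G3`** (sub-goal G3 of stub `stub_friendsPi1`, line `mk_friends`): in the
closed smooth `4`-manifold `X ⊃ C = i(D_k) ∪ f₀(𝔻²)` of the friends construction (germ chart `i` of the
model dotted handlebody `D_k` on an open `U ⊇ D_k`, core disc `f₀`), every loop of `X` based at a
point off the core `C` is homotopic rel base point to a loop off `C` — i.e. `π₁(X ∖ C) → π₁(X)` is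
onto.  First off `i(D_k)` (`FriendsPi1.exists_path_notMem_image_modelHandlebody`: lift through the
open embedding `i|_U`, general position and radial push in the model), then off `f₀(𝔻²)` staying off
`i(D_k)` (`FriendsPi1.exists_path_notMem_union`: codimension-`2` general position in charts), both by
the path decomposition of Hatcher's Lemma 1.15. [cite: HatcherAT2002, Lemma 1.15] -/
theorem helper_friendsPi1_G3 : ∀ (k : ℕ) (K₀ : (Metric.sphere (0 : EuclideanSpace ℝ (Fin 2)) 1) → EuclideanSpace ℝ (Fin 4)), Literature.Topology.FourManifolds.MMSW.IsModelKnot k K₀ → ∀ (X : Type) [TopologicalSpace X] [T2Space X] [SecondCountableTopology X] [ChartedSpace (EuclideanSpace ℝ (Fin 4)) X] [IsManifold (𝓡 4) ((⊤ : ℕ∞) : WithTop ℕ∞) X] [CompactSpace X] (U : Set (EuclideanSpace ℝ (Fin 4))) (i : EuclideanSpace ℝ (Fin 4) → X) (f₀ : EuclideanSpace ℝ (Fin 2) → X) (g₀ : EuclideanSpace ℝ (Fin 2) → EuclideanSpace ℝ (Fin 4)), (IsOpen U ∧ Literature.Topology.FourManifolds.MMSW.modelHandlebody k ⊆ U ∧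 ContMDiffOn (𝓡 4) (𝓡 4) ((⊤ : ℕ∞) : WithTop ℕ∞) i U ∧ Set.InjOn i U ∧ (∀ x ∈ U, Function.Injective (mfderiv (𝓡 4) (𝓡 4) i x))) → (ContMDiff (𝓡 2) (𝓡 4) ((⊤ : ℕ∞) : WithTop ℕ∞) f₀ ∧ Set.InjOn f₀ (Metric.closedBall (0 : EuclideanSpace ℝ (Fin 2)) 1) ∧ (∀ x ∈ Metric.closedBall (0 : EuclideanSpace ℝ (Fin 2)) 1, Function.Injective (mfderiv (𝓡 2) (𝓡 4) f₀ x)) ∧ (∀ x : EuclideanSpace ℝ (Fin 2), ‖x‖ < 1 → f₀ x ∉ i '' Literature.Topology.FourManifolds.MMSW.modelHandlebody k) ∧ (∀ t : (Metric.sphere (0 : EuclideanSpace ℝ (Fin 2)) 1), f₀ t = i (K₀ t)) ∧ ContDiff ℝ ((⊤ : ℕ∞) : WithTop ℕ∞) g₀ ∧ (∃ η : ℝ, 0 < η ∧ (∀ x : EuclideanSpace ℝ (Fin 2), 1 - η < ‖x‖ → ‖x‖ ≤ 1 → g₀ x ∈ U ∧ f₀ x = i (g₀ x))) ∧ (∀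 t : (Metric.sphere (0 : EuclideanSpace ℝ (Fin 2)) 1), deriv (fun ρ : ℝ => Literature.Topology.FourManifolds.MMSW.levelFun k (g₀ (ρ • (t : EuclideanSpace ℝ (Fin 2))))) 1 < 0)) → ∀ (x : X), x ∉ (i '' Literature.Topology.FourManifolds.MMSW.modelHandlebody k ∪ f₀ '' Metric.closedBall (0 : EuclideanSpace ℝ (Fin 2)) 1) → ∀ (γ : Path x x), ∃ γ' : Path x x, (∀ t, γ' t ∉ (i '' Literature.Topology.FourManifolds.MMSW.modelHandlebody k ∪ f₀ '' Metric.closedBall (0 : EuclideanSpace ℝ (Fin 2)) 1)) ∧ γ.Homotopic γ' := by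
  intro k K₀ _ X _ _ _ _ _ _ U i f₀ g₀ hgerm hdisc x hx γ
  obtain ⟨hUo, hDU, hi, hinj, himm⟩ := hgerm
  obtain ⟨hf₀, -⟩ := hdisc
  have hic : ContinuousOn i U := hi.continuousOn
  have hemb : Topology.IsOpenEmbedding (U.restrict i) :=
    FriendsH2.isOpenEmbedding_restrict_of_germChart hUo hi hinj himm
  have hAcl : IsClosed (i '' modelHandlebody k) :=
    ((isCompact_modelHandlebody k).image_of_continuousOn (hic.mono hDU)).isClosed
  have hBcl : IsClosed (f₀ '' Metric.closedBall (0 : EuclideanSpace ℝ (Fin 2)) 1) :=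
    ((isCompact_closedBall _ _).image hf₀.continuous).isClosed
  -- step 1: off `i(D_k)`
  obtain ⟨γ₁, hγ₁, hγγ₁⟩ := FriendsPi1.exists_path_notMem_image_modelHandlebody hUo hDU hic hinj hemb γ
    (fun h => hx (Or.inl h)) (fun h => hx (Or.inl h))
  -- step 2: off `f₀(𝔻²)`, staying off `i(D_k)`
  obtain ⟨γ₂, hγ₂, hγ₁γ₂⟩ := FriendsPi1.exists_path_notMem_union hf₀ hAcl (hAcl.union hBcl)
    (image_subset_range _ _) γ₁ hγ₁ hx hx
  exact ⟨γ₂, hγ₂, hγγ₁.trans hγ₁γ₂⟩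

end Summit.SmoothPoincare4.SmoothPoincare4.Theorems.DcrGap.MkFriends

end
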